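import Mathlib.GroupTheory.Perm.Cycle.Basic
import Mathlib.GroupTheory.Perm.Fin
import HarnessLib

/-!
# Venture HSemireg — a 5-cycle on six letters stabilises no 2-subset orbit structure

Seat w1-tw-1 of the computation cell `pub-hsemireg` (W1, CC note §26.7 (P3) SECOND ROUTE of
`widen/W1/CLEAN-COMPONENT-THEOREM-w1tw1.md`, TEST P-2′ in `widen/W1/w1tw1/testp/frob.gp`). There the
factorisation pattern `(5,1)` of a sextic at a rational point exhibits a 5-cycle `σ` in the ARITHMETIC root
monodromy group, which normalises the GEOMETRIC one `G_N`; a `G_N`-stable pair `{a, b}` (an orbit of size two,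
or two fixed letters) would have all its translates `σ^i {a, b}` again `G_N`-orbits, hence equal to or disjoint
from `{a, b}`. The present file records the purely combinatorial fact that this is impossible:

* `not_forall_pair_translate_eq_or_disjoint` — for a cycle `σ` of `Equiv.Perm (Fin 6)` with support of size
  five and `a ≠ b`, it is NOT the case that every translate `{(σ^i) a, (σ^i) b}` equals `{a, b}` or is disjoint
  from it.

HONEST FRAMING. Elementary finite combinatorics of one permutation of six letters; no curve, surface or
semiregularity map appears; nothing here says that HC, HC_CM or HC_AV holds, and nothing here is a new case of
anything.
-/

namespace Summit.Ventures.HSemireg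

namespace FiveCycleNoStablePair

open Equiv Equiv.Perm Finset

/-- A cycle of `Equiv.Perm (Fin 6)` with support of size five moves every letter but one: if it fixes `a`
and `a ≠ b` then it moves `b`. -/
theorem apply_ne_of_apply_eq {σ : Perm (Fin 6)} (h5 : #σ.support = 5) {a b : Fin 6} (hab : a ≠ b)
    (ha : σ a = a) : σ b ≠ b := by
  intro hb
  have hsub : σ.support ⊆ ((univ : Finset (Fin 6)).erase a).erase b := by
    intro x hx
    rw [mem_support] at hx
    simp only [mem_erase, mem_univ, and_true]
    refine ⟨?_, ?_⟩
    · rintro rfl; exact hx hb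
    · rintro rfl; exact hx ha
  have hcard := card_le_card hsub
  rw [card_erase_of_mem (by simpa using hab.symm), card_erase_of_mem (mem_univ _), card_univ,
    Fintype.card_fin, h5] at hcard
  omega

/-- **Orbit-partition lemma (combinatorial core).** Let `σ ∈ S₆` be a cycle with support of size five and
`a ≠ b`. Then some translate `{(σ^i) a, (σ^i) b}` is neither equal to `{a, b}` nor disjoint from it. -/
theorem not_forall_pair_translate_eq_or_disjoint {σ : Perm (Fin 6)} (hσ : σ.IsCycle)
    (h5 : #σ.support = 5) {a b : Fin 6} (hab : a ≠ b) :
    ¬ ∀ i : ℕ, ({(σ ^ i) a, (σ ^ i) b} : Finset (Fin 6)) = {a, b}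
        ∨ Disjoint ({(σ ^ i) a, (σ ^ i) b} : Finset (Fin 6)) {a, b} := by
  intro h
  have hord : orderOf σ = 5 := by rw [hσ.orderOf, h5]
  -- the case where one of the two letters is fixed
  have key : ∀ {a b : Fin 6}, a ≠ b → σ a = a →
      ¬ (({(σ ^ 1) a, (σ ^ 1) b} : Finset (Fin 6)) = {a, b}
        ∨ Disjoint ({(σ ^ 1) a, (σ ^ 1) b} : Finset (Fin 6)) {a, b}) := by
    intro a b hab ha hor
    have hb : σ b ≠ b := apply_ne_of_apply_eq h5 hab ha
    simp only [pow_one, ha] at hor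
    rcases hor with heq | hdis
    · have : σ b ∈ ({a, b} : Finset (Fin 6)) := by rw [← heq]; simp
      simp only [mem_insert, mem_singleton] at this
      rcases this with h1 | h1
      · exact (hab (σ.injective (ha.trans h1.symm))).elim
      · exact hb h1
    · exact disjoint_left.mp hdis (show a ∈ ({a, σ b} : Finset (Fin 6)) by simp)
        (show a ∈ ({a, b} : Finset (Fin 6)) by simp)
  by_cases ha : σ a = a
  · exact key hab ha (h 1)
  by_cases hb : σ b = b
  · have h1 := h 1
    have : ({(σ ^ 1) b, (σ ^ 1) a} : Finset (Fin 6)) = {b, a}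
        ∨ Disjoint ({(σ ^ 1) b, (σ ^ 1) a} : Finset (Fin 6)) {b, a} := by
      simpa only [pair_comm] using h1
    exact key hab.symm hb this
  -- both letters are moved: they lie in the one non-trivial cycle
  obtain ⟨i, hi⟩ := hσ.exists_pow_eq ha hb
  rcases h i with heq | hdis
  · have hmem : (σ ^ i) b ∈ ({a, b} : Finset (Fin 6)) := by rw [← heq]; simp
    simp only [mem_insert, mem_singleton] at hmem
    rcases hmem with hba | hbb
    · -- (σ^i) a = b and (σ^i) b = a: then σ^(2i) fixes a, so 5 ∣ 2 i, so 5 ∣ i, so (σ^i) a = a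
      have h2 : (σ ^ (2 * i)) a = a := by rw [two_mul, pow_add, mul_apply, hi, hba]
      have hone : σ ^ (2 * i) = 1 := (hσ.pow_eq_one_iff' ha).mpr h2
      have hdvd : 5 ∣ 2 * i := by rw [← hord]; exact orderOf_dvd_of_pow_eq_one hone
      have hdvd' : 5 ∣ i := (Nat.Coprime.dvd_mul_left (by norm_num : Nat.Coprime 5 2)).mp hdvd
      have hone' : σ ^ i = 1 := orderOf_dvd_iff_pow_eq_one.mp (hord ▸ hdvd')
      rw [hone', one_apply] at hi
      exact hab hi
    · have hone : σ ^ i = 1 := (hσ.pow_eq_one_iff' hb).mpr hbb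
      rw [hone, one_apply] at hi
      exact hab hi
  · exact disjoint_left.mp hdis (show b ∈ ({(σ ^ i) a, (σ ^ i) b} : Finset (Fin 6)) by simp [hi])
      (show b ∈ ({a, b} : Finset (Fin 6)) by simp)

end FiveCycleNoStablePair

end Summit.Ventures.HSemireg
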